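import Summits.RiemannHypothesis.RiemannHypothesis.Theorems.WeilFormatCPolyWindowMixedEntry
import Summits.RiemannHypothesis.RiemannHypothesis.Theorems.WeilFormatCWindowCoeffDecay
import HarnessLib

/-!
# Format C, design C∞: the mixed entries `W_a(1x^j, χ_m)` REGROUPED by their `m`-families

Route context: Fourier–Galerkin / Schur-complement certificates of Weil positivity on a window ("format C";
cell memo `run/shared/lean/pub/rh-explicit/rh-explicit-weil-10/KERNEL-LEVER.md` §19–§20, sizing note
`run/shared/lean/pub/rh-explicit/rh-explicit-weil-2/gen9/CINF-DOOR-SIZING.md` §3/§6 item (i); supporting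
stmt-RiemannHypothesis-0098; seat rh-explicit-weil-10).

`WeilFormatCPolyWindowMixedEntry.weilWindowSesq_indicator_pow_chi` gives `W_a(1x^j, χ_m)` (`m ≠ 0`) as pole + prime + arch −
Markov pieces.  The structured `Uq` tail of the C∞ door (`WeilFormatCDeflatedFarCouplingGram`) needs the SAME quantity as a
finite combination of `m`-FAMILY FUNCTIONS with `m`-independent coefficients.  This file is that regrouping (pure algebra on
the closed form): with `X_m = −iω_m` (`ω_m = πm/a`), `E^±(m) = Σ_{log n<2a} Λ(n)n^{-1/2} e^{±iω_m log n}`,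
`J^±(m) = ∫_{(0,2a]} ρ(t)(1 − e^{±iω_m t}) dt`,

`W_a(1x^j, χ_m) = (2a)^{-1/2} (−1)^m · [ 4C_j(e^{a/2} − e^{−a/2})·1/(1+4ω_m²) − 8S_j(e^{a/2} − e^{−a/2})·i·ω_m/(1+4ω_m²)`
`   + Σ_{k≤j} (−1)^k j^{(k)} X_m^{−(k+1)} · ( K_{j,k}(a) + a^{j−k}(J⁺(m) − E⁺(m)) − (−a)^{j−k}(J⁻(m) − E⁻(m)) ) ]`

with the `m`-INDEPENDENT constants
`K_{j,k}(a) = Σ_n Λ(n)n^{-1/2}[a^{j−k} − (−a)^{j−k} + (a^{j−k} − (a−log n)^{j−k}) + ((log n − a)^{j−k} − (−a)^{j−k})]`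
`          + ∫_{(0,2a]} ρ P_{j−k} + (2∫_{(2a,∞)} ρ − M_a)(a^{j−k} − (−a)^{j−k})`
(`C_j, S_j` the pole integrals of `x^j`, `P_q` the mixed polynomial kernel, `M_a` the Markov constant):

* `sum_mul_sum_regroup`, `sum_mul_regroup3` — the generic exchange-and-split of the prime double sum and of the `k`-sum;
* **`weilWindowSesq_indicator_pow_chi_regroup`** — the displayed identity;
* `inv_negI_freq_pow` — `X_m^{−(k+1)} = (ia/(πm))^{k+1}`, and `sum_vonMangoldt_cexp_freq_eq` — `E^±(m) = C_m ± iS_m` with the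
  real prime sums `C_m = Σ w_n cos(ω_m log n)`, `S_m = Σ w_n sin(ω_m log n)` (the real family functions; `J^± = J_c ∓ iJ_s` is
  `setIntegral_weilArchDensity_mul_one_sub_cexp(_neg)`).

So the `m`-dependence of every image is confined to `(−1)^m`, the powers `m^{−(k+1)}` (`k ≤ j`), the prime sums `C_m, S_m`,
the archimedean families `J_c(m), J_s(m)` (`WeilFormatCMixedArchAsymptotics`: `π/4 + O(1/m)`, `½log|ω_m| + κ(a) + O(1/m²)`) and the
polar pair.  Pure algebra; standard axioms; no RH claim.
-/

set_option autoImplicit false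
-- `Summit.RiemannHypothesis.RiemannHypothesis.…` is the layout-mandated namespace (summit = problem name).
set_option linter.dupNamespace false

noncomputable section

open Complex Filter Set MeasureTheory
open scoped Real Topology ComplexConjugate ArithmeticFunction.vonMangoldt

namespace Summit.RiemannHypothesis.RiemannHypothesis.Theorems.WeilFormatC

open Literature.NumberTheory.LFunctions Literature.NumberTheory.LFunctions.Yoshida1992
  Literature.Analysis.SpecialFunctions

variable {a : ℝ}

/-! ## Generic regrouping of the prime double sum -/

/-- **Exchange and split**: `Σ_n W_n·(c₀ Σ_k u_k (A_k(1 − e⁺_n) − B_k(1 − e⁻_n) + p_{k,n} + p'_{k,n}))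
= c₀ Σ_k u_k (Σ_n W_n (A_k − B_k + p_{k,n} + p'_{k,n}) − A_k Σ_n W_n e⁺_n + B_k Σ_n W_n e⁻_n)`. -/
theorem sum_mul_sum_regroup (s K : Finset ℕ) (W : ℕ → ℂ) (c₀ : ℂ) (u A B : ℕ → ℂ) (ep em : ℕ → ℂ)
    (p p' : ℕ → ℕ → ℂ) :
    ∑ n ∈ s, W n * (c₀ * ∑ k ∈ K, u k * (A k * (1 - ep n) - B k * (1 - em n) + p k n + p' k n))
      = c₀ * ∑ k ∈ K, u k *
          ((∑ n ∈ s, W n * (A k - B k + p k n + p' k n)) - A k * ∑ n ∈ s, W n * ep n + B k * ∑ n ∈ s, W n * em n) := by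
  have h1 : ∀ n, W n * (c₀ * ∑ k ∈ K, u k * (A k * (1 - ep n) - B k * (1 - em n) + p k n + p' k n))
      = ∑ k ∈ K, c₀ * (u k * (W n * (A k * (1 - ep n) - B k * (1 - em n) + p k n + p' k n))) := by
    intro n
    rw [Finset.mul_sum, Finset.mul_sum]
    exact Finset.sum_congr rfl fun k _ ↦ by ring
  rw [Finset.sum_congr rfl fun n _ ↦ h1 n, Finset.sum_comm, Finset.mul_sum]
  refine Finset.sum_congr rfl fun k _ ↦ ?_
  rw [← Finset.mul_sum, ← Finset.mul_sum]
  congr 2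
  rw [Finset.mul_sum, Finset.mul_sum, ← Finset.sum_sub_distrib, ← Finset.sum_add_distrib]
  exact Finset.sum_congr rfl fun n _ ↦ by ring

/-- Splitting the combined `k`-sum of the regrouped form back into its prime, archimedean and Fourier parts:
`Σ_k u_k (S_k + P_k + t·F_k + α_k(J⁺ − E⁺) − β_k(J⁻ − E⁻)) = Σ_k u_k(S_k − α_kE⁺ + β_kE⁻) + Σ_k u_k(α_kJ⁺ − β_kJ⁻ + P_k) + t·Σ_k u_kF_k`. -/
theorem sum_mul_regroup3 (K : Finset ℕ) (u S P F α β : ℕ → ℂ) (t Jp Jm Ep Em : ℂ) :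
    ∑ k ∈ K, u k * (S k + P k + t * F k + α k * (Jp - Ep) - β k * (Jm - Em))
      = ∑ k ∈ K, u k * (S k - α k * Ep + β k * Em) + ∑ k ∈ K, u k * (α k * Jp - β k * Jm + P k)
        + t * ∑ k ∈ K, u k * F k := by
  rw [Finset.mul_sum, ← Finset.sum_add_distrib, ← Finset.sum_add_distrib]
  exact Finset.sum_congr rfl fun k _ ↦ by ring

/-! ## The regrouped mixed entry -/

/-- **The mixed entry regrouped by `m`-families** (`a > 0`, `m ≠ 0`) — see the module docstring for the displayed form.
The constants multiplying `X_m^{−(k+1)} = (−iω_m)^{−(k+1)}` inside the `k`-sum are `m`-independent; the `m`-dependence is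
carried by `(−1)^m`, `X_m^{−(k+1)}`, `E^±(m) = Σ_n Λ(n)n^{-1/2}e^{±iω_m log n}`, `J^±(m) = ∫_{(0,2a]} ρ(1 − e^{±iω_m t})` and the
polar pair `1/(1+4ω_m²)`, `ω_m/(1+4ω_m²)`. -/
theorem weilWindowSesq_indicator_pow_chi_regroup (ha : 0 < a) {m : ℤ} (hm : m ≠ 0) (j : ℕ) :
    weilWindowSesq a ((Icc (-a) a).indicator fun x : ℝ ↦ ((x : ℂ)) ^ j) (chi a m) =
      ((1 / Real.sqrt (2 * a) : ℝ) : ℂ) * (-1 : ℂ) ^ m *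
        ( ((4 * (∫ x in (-a)..a, x ^ j * Real.cosh (x / 2)) * (Real.exp (a / 2) - Real.exp (-(a / 2))) : ℝ) : ℂ)
              * (((1 / (1 + 4 * (π * m / a) ^ 2) : ℝ)) : ℂ)
          - ((8 * (∫ x in (-a)..a, x ^ j * Real.sinh (x / 2)) * (Real.exp (a / 2) - Real.exp (-(a / 2))) : ℝ) : ℂ)
              * ((((π * m / a) / (1 + 4 * (π * m / a) ^ 2) : ℝ)) : ℂ) * I
          + ∑ k ∈ Finset.range (j + 1), (-1 : ℂ) ^ k * (j.descFactorial k : ℂ) / (-(I * (π * m / a : ℝ))) ^ (k + 1) *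
              ( ((∑ n ∈ weilPrimeIndex a, ((Λ n : ℝ) / Real.sqrt n : ℂ) *
                    (((a : ℂ)) ^ (j - k) - (((-a : ℝ)) : ℂ) ^ (j - k)
                      + (((a : ℂ)) ^ (j - k) - (((a - Real.log n : ℝ)) : ℂ) ^ (j - k))
                      + ((((-a + Real.log n : ℝ)) : ℂ) ^ (j - k) - (((-a : ℝ)) : ℂ) ^ (j - k))))
                  + ((∫ t in Ioc 0 (2 * a), weilArchDensity t *
                      ((a ^ (j - k) - (a - t) ^ (j - k)) + ((-a + t) ^ (j - k) - (-a) ^ (j - k))) : ℝ) : ℂ)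
                  + (2 * ((∫ t in Ioi (2 * a), weilArchDensity t : ℝ) : ℂ) - (weilMarkovConstant a : ℂ))
                      * (((a : ℂ)) ^ (j - k) - (((-a : ℝ)) : ℂ) ^ (j - k)))
                + ((a : ℂ)) ^ (j - k) *
                    ((∫ t in Ioc 0 (2 * a), (weilArchDensity t : ℂ) * (1 - cexp (I * ((π * m / a : ℝ) : ℂ) * (t : ℂ))))
                      - ∑ n ∈ weilPrimeIndex a, ((Λ n : ℝ) / Real.sqrt n : ℂ) * cexp (I * (π * m / a : ℝ) * (Real.log n : ℝ)))
                - (((-a : ℝ)) : ℂ) ^ (j - k) *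
                    ((∫ t in Ioc 0 (2 * a), (weilArchDensity t : ℂ) * (1 - cexp (-(I * ((π * m / a : ℝ) : ℂ) * (t : ℂ)))))
                      - ∑ n ∈ weilPrimeIndex a, ((Λ n : ℝ) / Real.sqrt n : ℂ) *
                          cexp (-(I * (π * m / a : ℝ) * (Real.log n : ℝ)))) ) ) := by
  rw [weilWindowSesq_indicator_pow_chi ha hm j, fourierCoeff_ofReal_pow_eq_sum ha.ne' hm j]
  -- atoms
  have hsq : Real.sqrt (2 * a) ≠ 0 := (Real.sqrt_pos.2 (by positivity)).ne'
  have hden : (1 : ℝ) + 4 * (π * m / a) ^ 2 ≠ 0 := by positivity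
  set N0 : ℂ := ((1 / Real.sqrt (2 * a) : ℝ) : ℂ) with hN0
  set sgn : ℂ := (-1 : ℂ) ^ m with hsgn
  set X : ℂ := -(I * (π * m / a : ℝ)) with hX
  set Jp : ℂ := ∫ t in Ioc 0 (2 * a), (weilArchDensity t : ℂ) * (1 - cexp (I * ((π * m / a : ℝ) : ℂ) * (t : ℂ))) with hJp
  set Jm : ℂ := ∫ t in Ioc 0 (2 * a), (weilArchDensity t : ℂ) * (1 - cexp (-(I * ((π * m / a : ℝ) : ℂ) * (t : ℂ))))
    with hJm
  set Ep : ℂ := ∑ n ∈ weilPrimeIndex a, ((Λ n : ℝ) / Real.sqrt n : ℂ) * cexp (I * (π * m / a : ℝ) * (Real.log n : ℝ))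
    with hEp
  set Em : ℂ := ∑ n ∈ weilPrimeIndex a, ((Λ n : ℝ) / Real.sqrt n : ℂ) * cexp (-(I * (π * m / a : ℝ) * (Real.log n : ℝ)))
    with hEm
  set ρt : ℂ := ((∫ t in Ioi (2 * a), weilArchDensity t : ℝ) : ℂ) with hρt
  set Mk : ℂ := (weilMarkovConstant a : ℂ) with hMk
  -- the prime block, regrouped
  have hprime :
      (∑ n ∈ weilPrimeIndex a, ((Λ n : ℝ) / Real.sqrt n : ℂ) *
          (N0 * sgn *
            ∑ k ∈ Finset.range (j + 1), (-1 : ℂ) ^ k * (j.descFactorial k : ℂ) / X ^ (k + 1) *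
              (((a : ℂ)) ^ (j - k) * (1 - cexp (I * (π * m / a : ℝ) * (Real.log n : ℝ)))
                - (((-a : ℝ)) : ℂ) ^ (j - k) * (1 - cexp (-(I * (π * m / a : ℝ) * (Real.log n : ℝ))))
                + (((a : ℂ)) ^ (j - k) - (((a - Real.log n : ℝ)) : ℂ) ^ (j - k))
                + ((((-a + Real.log n : ℝ)) : ℂ) ^ (j - k) - (((-a : ℝ)) : ℂ) ^ (j - k)))))
        = N0 * sgn * ∑ k ∈ Finset.range (j + 1), (-1 : ℂ) ^ k * (j.descFactorial k : ℂ) / X ^ (k + 1) *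
            ((∑ n ∈ weilPrimeIndex a, ((Λ n : ℝ) / Real.sqrt n : ℂ) *
                (((a : ℂ)) ^ (j - k) - (((-a : ℝ)) : ℂ) ^ (j - k)
                  + (((a : ℂ)) ^ (j - k) - (((a - Real.log n : ℝ)) : ℂ) ^ (j - k))
                  + ((((-a + Real.log n : ℝ)) : ℂ) ^ (j - k) - (((-a : ℝ)) : ℂ) ^ (j - k))))
              - ((a : ℂ)) ^ (j - k) * Ep + (((-a : ℝ)) : ℂ) ^ (j - k) * Em) :=
    sum_mul_sum_regroup (weilPrimeIndex a) (Finset.range (j + 1)) (fun n ↦ ((Λ n : ℝ) / Real.sqrt n : ℂ)) (N0 * sgn)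
      (fun k ↦ (-1 : ℂ) ^ k * (j.descFactorial k : ℂ) / X ^ (k + 1)) (fun k ↦ ((a : ℂ)) ^ (j - k))
      (fun k ↦ (((-a : ℝ)) : ℂ) ^ (j - k)) (fun n ↦ cexp (I * (π * m / a : ℝ) * (Real.log n : ℝ)))
      (fun n ↦ cexp (-(I * (π * m / a : ℝ) * (Real.log n : ℝ))))
      (fun k n ↦ ((a : ℂ)) ^ (j - k) - (((a - Real.log n : ℝ)) : ℂ) ^ (j - k))
      (fun k n ↦ (((-a + Real.log n : ℝ)) : ℂ) ^ (j - k) - (((-a : ℝ)) : ℂ) ^ (j - k))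
  -- the Fourier base
  have hbase : (I * (π * ((-m : ℤ) : ℝ) / a : ℝ) : ℂ) = X := by
    rw [hX]; push_cast; ring
  rw [hprime, hbase]
  -- the polar scalars
  have hpolc : ((2 * (∫ x in (-a)..a, x ^ j * Real.cosh (x / 2)) *
        ((-1 : ℝ) ^ m * (2 * (Real.exp (a / 2) - Real.exp (-(a / 2)))) /
          (Real.sqrt (2 * a) * (1 + 4 * (π * m / a) ^ 2))) : ℝ) : ℂ)
      = N0 * sgn * (((4 * (∫ x in (-a)..a, x ^ j * Real.cosh (x / 2)) * (Real.exp (a / 2) - Real.exp (-(a / 2))) : ℝ) : ℂ)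
          * (((1 / (1 + 4 * (π * m / a) ^ 2) : ℝ)) : ℂ)) := by
    rw [hN0, hsgn]
    push_cast
    field_simp
    ring
  have hpols : ((2 * (∫ x in (-a)..a, x ^ j * Real.sinh (x / 2)) *
        (-((-1 : ℝ) ^ m * (4 * (π * m / a) * (Real.exp (a / 2) - Real.exp (-(a / 2))))) /
          (Real.sqrt (2 * a) * (1 + 4 * (π * m / a) ^ 2))) : ℝ) : ℂ) * I
      = -(N0 * sgn * (((8 * (∫ x in (-a)..a, x ^ j * Real.sinh (x / 2)) * (Real.exp (a / 2) - Real.exp (-(a / 2))) : ℝ) : ℂ)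
          * ((((π * m / a) / (1 + 4 * (π * m / a) ^ 2) : ℝ)) : ℂ) * I)) := by
    rw [hN0, hsgn]
    push_cast
    field_simp
    ring
  rw [hpolc, hpols]
  -- normalise the Fourier sum and split the combined `k`-sum
  have hF : ∑ k ∈ Finset.range (j + 1), (-1 : ℂ) ^ k * (j.descFactorial k : ℂ)
        * (((a : ℂ)) ^ (j - k) - (((-a : ℝ) : ℂ)) ^ (j - k)) / X ^ (k + 1)
      = ∑ k ∈ Finset.range (j + 1), (-1 : ℂ) ^ k * (j.descFactorial k : ℂ) / X ^ (k + 1)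
        * (((a : ℂ)) ^ (j - k) - (((-a : ℝ) : ℂ)) ^ (j - k)) :=
    Finset.sum_congr rfl fun k _ ↦ by ring
  rw [hF, sum_mul_regroup3]
  ring

/-! ## The elementary `m`-families behind `X_m^{−(k+1)}` and `E^±(m)` -/

/-- `X_m^{−(k+1)} = (ia/(πm))^{k+1}`: `1/(−iω_m)^{k+1} = (i·a/(πm))^{k+1}` (`m ≠ 0`, `a ≠ 0`). -/
theorem inv_negI_freq_pow (ha : a ≠ 0) {m : ℤ} (hm : m ≠ 0) (k : ℕ) :
    1 / (-(I * (π * m / a : ℝ))) ^ (k + 1) = (I * (a / (π * m) : ℝ)) ^ (k + 1) := by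
  have hω : ((π * m / a : ℝ) : ℂ) ≠ 0 := by
    exact_mod_cast div_ne_zero (mul_ne_zero Real.pi_ne_zero (Int.cast_ne_zero.mpr hm)) ha
  rw [one_div, ← inv_pow]
  congr 1
  have e : ((a / (π * m) : ℝ) : ℂ) = ((π * m / a : ℝ) : ℂ)⁻¹ := by
    push_cast
    rw [inv_div]
  rw [e, inv_neg, mul_inv, Complex.inv_I]
  ring

/-- **`E^±(m) = C_m ± iS_m`**: `Σ_n w_n e^{±iω log n} = Σ_n w_n cos(ω log n) ± i Σ_n w_n sin(ω log n)`. -/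
theorem sum_vonMangoldt_cexp_freq_eq (a ω : ℝ) :
    (∑ n ∈ weilPrimeIndex a, ((Λ n : ℝ) / Real.sqrt n : ℂ) * cexp (I * (ω : ℂ) * (Real.log n : ℝ))
        = ((∑ n ∈ weilPrimeIndex a, (Λ n : ℝ) / Real.sqrt n * Real.cos (ω * Real.log n) : ℝ) : ℂ)
          + I * ((∑ n ∈ weilPrimeIndex a, (Λ n : ℝ) / Real.sqrt n * Real.sin (ω * Real.log n) : ℝ) : ℂ))
    ∧ (∑ n ∈ weilPrimeIndex a, ((Λ n : ℝ) / Real.sqrt n : ℂ) * cexp (-(I * (ω : ℂ) * (Real.log n : ℝ)))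
        = ((∑ n ∈ weilPrimeIndex a, (Λ n : ℝ) / Real.sqrt n * Real.cos (ω * Real.log n) : ℝ) : ℂ)
          - I * ((∑ n ∈ weilPrimeIndex a, (Λ n : ℝ) / Real.sqrt n * Real.sin (ω * Real.log n) : ℝ) : ℂ)) := by
  have e1 : ∀ n : ℕ, I * (ω : ℂ) * ((Real.log n : ℝ) : ℂ) = ((ω * Real.log n : ℝ) : ℂ) * I := fun n ↦ by
    rw [Complex.ofReal_mul]; ring
  constructor
  · rw [Complex.ofReal_sum, Complex.ofReal_sum, Finset.mul_sum, ← Finset.sum_add_distrib]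
    refine Finset.sum_congr rfl fun n _ ↦ ?_
    rw [e1 n, Complex.exp_mul_I]
    push_cast
    ring
  · rw [Complex.ofReal_sum, Complex.ofReal_sum, Finset.mul_sum, ← Finset.sum_sub_distrib]
    refine Finset.sum_congr rfl fun n _ ↦ ?_
    have e2 : -(I * (ω : ℂ) * ((Real.log n : ℝ) : ℂ)) = -((ω * Real.log n : ℝ) : ℂ) * I := by
      rw [e1 n]; ring
    rw [e2, Complex.exp_mul_I, Complex.cos_neg, Complex.sin_neg]
    push_cast
    ring

end Summit.RiemannHypothesis.RiemannHypothesis.Theorems.WeilFormatC
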